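import Literature.NumberTheory.Sieve.IwaniecAlmostPrimesRootExpSum
import Literature.NumberTheory.Sieve.IwaniecAlmostPrimesHooley
import Literature.NumberTheory.LFunctions.KloostermanWeilPrimeProofs
import HarnessLib

/-!
# Hooley 1963: incomplete Kloosterman sums over long intervals and the divisor-sum bookkeeping (PROVED)

Topic `Literature/NumberTheory/Sieve`.  Analytic core of the tree's proof of C. Hooley's power-saving
estimate for the Weyl sums over the roots of a quadratic congruence to ALL moduli
(C. Hooley, *On the number of divisors of quadratic polynomials*, Acta Math. 110 (1963) 97–114, §6;
restated with the bound `∑_{n ≤ x} ρ_h(n) ≪ x^{3/4} (log x)²` in W. Duke, J. B. Friedlander,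
H. Iwaniec, Ann. of Math. 141 (1995), p. 424, (5)).  After Hooley's passage from the roots
`ν (mod n)` of `ν² ≡ D (mod n)` to primitive representations `n = P(p, r)` by the binary quadratic
forms `P` of discriminant `4D` and his fraction formula `ν/n ≡ p̄/r − (2Ap + Br)/(2rP(p,r)) (mod 1)`
(the tree's `QuadraticRootsAllModuliVectors.lean`), the Weyl sum becomes, for each `r ≤ c√N`, an
incomplete Kloosterman-type sum `∑_{p ∈ J_r, (p,r)=1} e(h p̄/r)` over an interval `J_r` of length
`≪ √N`, twisted by a factor `1 + O(1/r²)`.  This file PROVES the two elementary estimates that turn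
this into `O(N^{3/4} (log N)²)`:

* `norm_sum_Ioo_hooleyPhase_le` — **incomplete Kloosterman sums over an interval of any length**:
  for `s ≥ 1` and integers `h`, `a ≤ b`,
  `|∑_{a < p < b, (p,s)=1} e(h p̄/s)| ≤ τ(s) s^{1/2} (h,s)^{1/2} (2(b − a)/s + 1 + log s)`
  (completion modulo `s`, Weil's bound `|S(m,n;s)| ≤ (m,n,s)^{1/2} s^{1/2} τ(s)` — the tree's PROVED
  `weil_kloosterman_bound_holds` — and `∑_{t mod s} min(V, 1/(2‖t/s‖)) ≤ 2V + s(1 + log s)`; this is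
  Hooley's Lemma 1 of Acta Math. 117 (1967) / Iwaniec's Lemma 6 (Invent. Math. 47 (1978)), whose
  tree version `Iwaniec1978.lemma6_hooley_of_weil` we follow, with the length restriction removed
  and the logarithm kept explicit instead of `s^ε`; cf. the tree's
  `KloostermanIncompleteInterval.lean` (`KI_sum_progression_le`), the same estimate over
  `Ioc`-intervals in a progression with the sharper Ramanujan-sum term at the zero frequency);
* `sum_card_divisors_div_sqrt_le`, `sum_card_divisors_mul_sqrt_le` — `∑_{m ≤ N} τ(m)/√m ≤ 2√N(1 + log N)`,
  `∑_{m ≤ N} τ(m)√m ≤ N√N (1 + log N)`;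
* `exists_norm_sum_sum_hooleyPhase_mul_le` — **the summation over the moduli**: if `R ≤ c₁√N`, the
  intervals `(a_r, b_r)` have length `≤ c₂√N` and the twists satisfy `|w_r(p) − 1| ≤ c₃/r²`, then
  `|∑_{r ≤ R} ∑_{a_r < p < b_r, (p,r)=1} e(h p̄/r) w_r(p)| ≤ C N^{3/4} (1 + log N)²` with `C`
  depending only on `h, c₁, c₂, c₃` — one logarithm from the completion, one from `∑_{r ≤ R} τ(r)`.

Everything here is proved; no statement of the papers is vendored (no new named fact, D-0026).
`e(h p̄/s)` is the tree's `Iwaniec1978.hooleyPhase h s p` (`p̄ = ((p mod s)⁻¹).val`).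

## References

* C. Hooley, Acta Math. 110 (1963), 97–114, §6 (the method; original not held).
  [cite: Hooley1963, §6]
* W. Duke, J. B. Friedlander, H. Iwaniec, Ann. of Math. 141 (1995), p. 424 (5) (the printed bound
  `x^{3/4}(log x)²`). [cite: DukeFriedlanderIwaniec1995, p. 424 (5)]
* H. Iwaniec, Invent. Math. 47 (1978), Lemma 6; C. Hooley, Acta Math. 117 (1967), Lemma 1
  (incomplete Kloosterman sums). [cite: IwaniecInventiones1978, Lemma 6]
* H. Iwaniec, *Spectral Methods of Automorphic Forms* (2002), (2.25) (Weil's bound).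
  [cite: Iwaniec2002, §2.5 (2.25)]
-/

noncomputable section

open Finset
open scoped FourierTransform

namespace Literature.NumberTheory.Sieve.Hooley1963

open Literature.NumberTheory.LFunctions (kloostermanSum weil_kloosterman_bound
  weil_kloosterman_bound_holds sum_zmod_eq_sum_range)
open Literature.NumberTheory.Sieve.Vinogradov (geomBound geomBound_nonneg)
open Literature.NumberTheory.Sieve.Iwaniec1978 (hooleyPhase norm_hooleyPhase
  hooley_term_eq_stdAddChar hooley_gcd_eq_one_iff_isUnit hooley_stdAddChar_mul_stdAddChar
  hooley_fourier_inversion hooley_transform_eq_kloostermanSum hooley_norm_kloostermanSum_le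
  hooley_norm_sum_range_fourierChar_le hooley_sum_geomBound_le)

/-! ### Incomplete Kloosterman sums over an interval of arbitrary length -/

/-- **Incomplete Kloosterman sums over an interval of any length** (Hooley 1967 Lemma 1 / Iwaniec
1978 Lemma 6 with the logarithm explicit and no restriction on the length): for `s ≥ 1` and
integers `h`, `a ≤ b`,
`|∑_{a < p < b, (p, s) = 1} e(h p̄/s)| ≤ τ(s) √s √(h, s) · (2(b − a)/s + 1 + log s)`.
Proof: complete modulo `s` (`[(p,s)=1] e_s(h p̄) = s⁻¹ ∑_t S(−t, h; s) e_s(tp)`), bound every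
`S` by Weil's bound `τ(s)√s √(h,s)` (`weil_kloosterman_bound_holds`) and the geometric sums by
`min(b − a, 1/(2‖t/s‖))`, whose sum over `t mod s` is `≤ 2(b − a) + s(1 + log s)`.
[cite: IwaniecInventiones1978, Lemma 6] -/
theorem norm_sum_Ioo_hooleyPhase_le {s : ℕ} (hs : 1 ≤ s) (h a b : ℤ) (hab : a ≤ b) :
    ‖∑ p ∈ (Finset.Ioo a b).filter (fun p : ℤ => Int.gcd p s = 1), hooleyPhase h s p‖ ≤
      (Nat.divisors s).card * Real.sqrt s * Real.sqrt (Int.gcd h s) *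
        (2 * ((b - a : ℤ) : ℝ) / s + 1 + Real.log s) := by
  classical
  haveI : NeZero s := ⟨by omega⟩
  have hs0 : 0 < s := by omega
  have hs0' : (0 : ℝ) < s := by exact_mod_cast hs0
  have hs1' : (1 : ℝ) ≤ s := by exact_mod_cast hs
  set ψs : AddChar (ZMod s) ℂ := ZMod.stdAddChar with hψs
  set hh : ZMod s := (h : ZMod s) with hhh
  set G : ZMod s → ℂ := fun u => if IsUnit u then (ψs (hh * u⁻¹) : ℂ) else 0 with hG
  set Gh : ZMod s → ℂ := fun t => ∑ u : ZMod s, G u * (ψs (-(t * u)) : ℂ) with hGh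
  set B : ℝ := (Nat.divisors s).card * Real.sqrt s * Real.sqrt (Int.gcd h s) with hB
  have hB0 : 0 ≤ B := by positivity
  have hGh_le : ∀ t, ‖Gh t‖ ≤ B := by
    intro t
    have := hooley_norm_kloostermanSum_le weil_kloosterman_bound_holds t h
    rw [← hooley_transform_eq_kloostermanSum] at this
    exact this
  -- `ψ_s(t·p) = e(p · t/s)` for an integer `p` (cf. the tree's `KI_stdAddChar_mul_intCast`)
  have hchar : ∀ (t : ZMod s) (p : ℤ),
      (ψs (t * (p : ZMod s)) : ℂ) = (𝐞 ((p : ℝ) * ((t.val : ℝ) / s)) : ℂ) := by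
    intro t p
    have h := hooley_stdAddChar_mul_stdAddChar t (0 : ZMod 1) p
    rw [zero_mul, AddChar.map_zero_eq_one, mul_one] at h
    rw [hψs, h]
    simp
  -- the run of consecutive integers `a < p < b` as `a + 1 + n`, `n < K`
  obtain ⟨K, hK⟩ : ∃ K : ℕ, (K : ℤ) = max (b - a - 1) 0 := ⟨(max (b - a - 1) 0).toNat, by omega⟩
  set V : ℝ := ((b - a : ℤ) : ℝ) with hV
  have hV0 : 0 ≤ V := by rw [hV]; exact_mod_cast (by omega : (0 : ℤ) ≤ b - a)
  have hKV : (K : ℝ) ≤ V := by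
    have : (K : ℤ) ≤ b - a := by omega
    rw [hV]; exact_mod_cast this
  set rr : ℕ → ℤ := fun n => a + 1 + (n : ℤ) with hrr
  have hIoo : Finset.Ioo a b = (Finset.range K).map ⟨rr, fun x y hxy => by
      simp only [hrr] at hxy; exact_mod_cast (add_left_cancel hxy)⟩ := by
    ext m
    simp only [Finset.mem_Ioo, Finset.mem_map, Finset.mem_range, Function.Embedding.coeFn_mk, hrr]
    constructor
    · rintro ⟨h1, h2⟩
      refine ⟨(m - a - 1).toNat, ?_, ?_⟩ <;> omega
    · rintro ⟨n, hn, rfl⟩; omega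
  -- Step 1: the summand through `G`
  have hstep1 : ∀ p : ℤ,
      (if Int.gcd p s = 1 then hooleyPhase h s p else 0) = G (p : ZMod s) := by
    intro p
    by_cases hg : Int.gcd p s = 1
    · rw [if_pos hg, hooleyPhase, hooley_term_eq_stdAddChar]
      simp only [hG, hhh, hψs]
      rw [if_pos ((hooley_gcd_eq_one_iff_isUnit p).mp hg)]
    · rw [if_neg hg]
      simp only [hG]
      rw [if_neg (fun hu => hg ((hooley_gcd_eq_one_iff_isUnit p).mpr hu))]
  -- Step 2: Fourier inversion `G(p) = s⁻¹ ∑_t Ĝ(t) ψ_s(t p)` and the interchange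
  have hGinv : ∀ p : ℤ, G (p : ZMod s) =
      (s : ℂ)⁻¹ * ∑ t : ZMod s, Gh t * (ψs (t * (p : ZMod s)) : ℂ) := by
    intro p
    have hinv := hooley_fourier_inversion G (p : ZMod s)
    have hs0c : (s : ℂ) ≠ 0 := Nat.cast_ne_zero.mpr (by omega)
    rw [hGh, hψs, hinv, ← mul_assoc, inv_mul_cancel₀ hs0c, one_mul]
  have hS_eq : ∑ p ∈ (Finset.Ioo a b).filter (fun p : ℤ => Int.gcd p s = 1), hooleyPhase h s p =
      (s : ℂ)⁻¹ * ∑ t : ZMod s, Gh t *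
        ∑ n ∈ Finset.range K, (𝐞 (((rr n : ℤ) : ℝ) * (((t.val : ℝ) / s))) : ℂ) := by
    rw [Finset.sum_filter, hIoo, Finset.sum_map]
    simp only [Function.Embedding.coeFn_mk]
    simp_rw [hstep1, hGinv]
    rw [← Finset.mul_sum]
    congr 1
    simp_rw [Finset.mul_sum]
    rw [Finset.sum_comm]
    refine Finset.sum_congr rfl fun t _ => Finset.sum_congr rfl fun n _ => ?_
    rw [hchar t (rr n)]
  -- Step 3: the bound
  rw [hS_eq, norm_mul, norm_inv, Complex.norm_natCast]
  have hsum : ‖∑ t : ZMod s, Gh t *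
      ∑ n ∈ Finset.range K, (𝐞 (((rr n : ℤ) : ℝ) * ((t.val : ℝ) / s)) : ℂ)‖ ≤
      B * (2 * V + s * (1 + Real.log s)) := by
    calc ‖∑ t : ZMod s, Gh t * ∑ n ∈ Finset.range K, (𝐞 (((rr n : ℤ) : ℝ) * ((t.val : ℝ) / s)) : ℂ)‖
        ≤ ∑ t : ZMod s, ‖Gh t * ∑ n ∈ Finset.range K, (𝐞 (((rr n : ℤ) : ℝ) * ((t.val : ℝ) / s)) : ℂ)‖ :=
          norm_sum_le _ _
      _ ≤ ∑ t : ZMod s, B * geomBound V ((t.val : ℝ) / s) := by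
          refine Finset.sum_le_sum fun t _ => ?_
          rw [norm_mul]
          refine mul_le_mul (hGh_le t) ?_ (norm_nonneg _) hB0
          have := hooley_norm_sum_range_fourierChar_le a ((t.val : ℝ) / s) hKV
          simpa only [hrr] using this
      _ = B * ∑ t ∈ Finset.range s, geomBound V ((t : ℝ) / s + 0) := by
          rw [← Finset.mul_sum, sum_zmod_eq_sum_range (fun t : ZMod s => geomBound V ((t.val : ℝ) / s))]
          congr 1
          refine Finset.sum_congr rfl fun t ht => ?_
          rw [Finset.mem_range] at ht
          rw [ZMod.val_natCast, Nat.mod_eq_of_lt ht, add_zero]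
      _ ≤ B * (2 * V + s * (1 + Real.log s)) :=
          mul_le_mul_of_nonneg_left (hooley_sum_geomBound_le hs0 0 hV0) hB0
  calc (s : ℝ)⁻¹ * ‖∑ t : ZMod s, Gh t *
        ∑ n ∈ Finset.range K, (𝐞 (((rr n : ℤ) : ℝ) * ((t.val : ℝ) / s)) : ℂ)‖
      ≤ (s : ℝ)⁻¹ * (B * (2 * V + s * (1 + Real.log s))) :=
        mul_le_mul_of_nonneg_left hsum (by positivity)
    _ = B * (2 * V / s + 1 + Real.log s) := by field_simp; ring

/-- The same bound with a twist `w` close to `1`: if `|w(p) − 1| ≤ c` on `(a, b)` then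
`|∑_{a<p<b, (p,s)=1} e(h p̄/s) w(p)| ≤ τ(s)√s√(h,s)(2(b − a)/s + 1 + log s) + (b − a)c`.
[folklore] -/
theorem norm_sum_Ioo_hooleyPhase_mul_le {s : ℕ} (hs : 1 ≤ s) (h a b : ℤ) (hab : a ≤ b)
    (w : ℤ → ℂ) {c : ℝ} (hc : 0 ≤ c) (hw : ∀ p ∈ Finset.Ioo a b, ‖w p - 1‖ ≤ c) :
    ‖∑ p ∈ (Finset.Ioo a b).filter (fun p : ℤ => Int.gcd p s = 1), hooleyPhase h s p * w p‖ ≤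
      (Nat.divisors s).card * Real.sqrt s * Real.sqrt (Int.gcd h s) *
        (2 * ((b - a : ℤ) : ℝ) / s + 1 + Real.log s) + ((b - a : ℤ) : ℝ) * c := by
  have hsplit : ∀ p, hooleyPhase h s p * w p = hooleyPhase h s p + hooleyPhase h s p * (w p - 1) := by
    intro p; ring
  simp_rw [hsplit]
  rw [Finset.sum_add_distrib]
  refine (norm_add_le _ _).trans (add_le_add (norm_sum_Ioo_hooleyPhase_le hs h a b hab) ?_)
  calc ‖∑ p ∈ (Finset.Ioo a b).filter (fun p : ℤ => Int.gcd p s = 1), hooleyPhase h s p * (w p - 1)‖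
      ≤ ∑ p ∈ (Finset.Ioo a b).filter (fun p : ℤ => Int.gcd p s = 1), ‖hooleyPhase h s p * (w p - 1)‖ :=
        norm_sum_le _ _
    _ ≤ ∑ p ∈ (Finset.Ioo a b).filter (fun p : ℤ => Int.gcd p s = 1), c := by
        refine Finset.sum_le_sum fun p hp => ?_
        rw [norm_mul, norm_hooleyPhase, one_mul]
        exact hw p (Finset.mem_filter.1 hp).1
    _ = ((Finset.Ioo a b).filter (fun p : ℤ => Int.gcd p s = 1)).card * c := by
        rw [Finset.sum_const, nsmul_eq_mul]
    _ ≤ ((b - a : ℤ) : ℝ) * c := by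
        refine mul_le_mul_of_nonneg_right ?_ hc
        have h1 : ((Finset.Ioo a b).filter (fun p : ℤ => Int.gcd p s = 1)).card ≤ (Finset.Ioo a b).card :=
          Finset.card_filter_le _ _
        have h2 : ((Finset.Ioo a b).card : ℤ) ≤ b - a := by
          rw [Int.card_Ioo]; omega
        have h3 : (((Finset.Ioo a b).filter (fun p : ℤ => Int.gcd p s = 1)).card : ℤ) ≤ b - a := by
          exact le_trans (by exact_mod_cast h1) h2
        exact_mod_cast h3

/-! ### Divisor sums -/

/-- **Dirichlet's bound, crude form**: `∑_{1 ≤ m ≤ N} τ(m) ≤ N (1 + log N)` (restated from the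
tree's `QuadraticRootsPrimeModuliDFISieveEstimates.lean` to keep the import closure small).
[folklore] -/
theorem sum_card_divisors_le (N : ℕ) :
    ∑ m ∈ Icc 1 N, ((Nat.divisors m).card : ℝ) ≤ N * (1 + Real.log N) := by
  have hI : ∀ n : ℕ, Icc 1 n = Ioc 0 n := fun n => by
    ext m; simp only [Finset.mem_Ioc, Finset.mem_Icc]; omega
  have h1 : ∑ m ∈ Icc 1 N, ((Nat.divisors m).card : ℝ) =
      ∑ m ∈ Icc 1 N, ∑ d ∈ Icc 1 N, (if d ∣ m then (1 : ℝ) else 0) := by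
    refine Finset.sum_congr rfl fun m hm => ?_
    rw [Finset.mem_Icc] at hm
    rw [← Finset.sum_filter, Finset.sum_const, nsmul_eq_mul, mul_one]
    congr 1
    congr 1
    ext d
    simp only [Nat.mem_divisors, Finset.mem_filter, Finset.mem_Icc]
    constructor
    · rintro ⟨hd, hm0⟩
      exact ⟨⟨Nat.pos_of_dvd_of_pos hd (by omega), (Nat.le_of_dvd (by omega) hd).trans hm.2⟩, hd⟩
    · rintro ⟨⟨-, -⟩, hd⟩
      exact ⟨hd, by omega⟩
  rw [h1, Finset.sum_comm]
  have h2 : ∀ d ∈ Icc 1 N, ∑ m ∈ Icc 1 N, (if d ∣ m then (1 : ℝ) else 0) ≤ (N : ℝ) * (d : ℝ)⁻¹ := by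
    intro d hd
    rw [Finset.mem_Icc] at hd
    rw [← Finset.sum_filter, Finset.sum_const, nsmul_eq_mul, mul_one, hI,
      Nat.Ioc_filter_dvd_card_eq_div, ← div_eq_mul_inv]
    exact Nat.cast_div_le
  refine (Finset.sum_le_sum h2).trans ?_
  rw [← Finset.mul_sum]
  have h3 : ∑ d ∈ Icc 1 N, (d : ℝ)⁻¹ = ((harmonic N : ℚ) : ℝ) := by
    rw [harmonic_eq_sum_Icc]; push_cast; rfl
  rw [h3]
  exact mul_le_mul_of_nonneg_left (harmonic_le_one_add_log N) (Nat.cast_nonneg N)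

/-- `∑_{1 ≤ e ≤ M} 1/√e ≤ 2√M` (`1/√e ≤ 2(√e − √(e−1))`). [folklore] -/
theorem sum_one_div_sqrt_le (M : ℕ) : ∑ e ∈ Icc 1 M, 1 / Real.sqrt e ≤ 2 * Real.sqrt M := by
  induction M with
  | zero => simp
  | succ n ih =>
    rw [Finset.sum_Icc_succ_top (by omega)]
    have hb : 0 < Real.sqrt ((n + 1 : ℕ) : ℝ) := Real.sqrt_pos.2 (by positivity)
    have hab : Real.sqrt ((n + 1 : ℕ) : ℝ) ^ 2 - Real.sqrt (n : ℝ) ^ 2 = 1 := by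
      rw [Real.sq_sqrt (by positivity), Real.sq_sqrt (by positivity)]; push_cast; ring
    have ha : 0 ≤ Real.sqrt (n : ℝ) := Real.sqrt_nonneg _
    have hstep : 1 / Real.sqrt ((n + 1 : ℕ) : ℝ) ≤
        2 * Real.sqrt ((n + 1 : ℕ) : ℝ) - 2 * Real.sqrt (n : ℝ) := by
      rw [div_le_iff₀ hb]
      nlinarith [sq_nonneg (Real.sqrt ((n + 1 : ℕ) : ℝ) - Real.sqrt (n : ℝ))]
    linarith

/-- The multiples of `d ≥ 1` in `[1, N]` are `d·e`, `1 ≤ e ≤ N/d`. [folklore] -/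
theorem filter_dvd_Icc_eq_image {d : ℕ} (hd : 1 ≤ d) (N : ℕ) :
    (Icc 1 N).filter (fun m => d ∣ m) = (Icc 1 (N / d)).image (fun e => d * e) := by
  ext m
  simp only [Finset.mem_filter, Finset.mem_Icc, Finset.mem_image]
  constructor
  · rintro ⟨⟨hm1, hmN⟩, ⟨e, rfl⟩⟩
    refine ⟨e, ⟨?_, ?_⟩, rfl⟩
    · rcases Nat.eq_zero_or_pos e with h0 | h0
      · subst h0; omega
      · exact h0
    · exact (Nat.le_div_iff_mul_le hd).2 (by rw [mul_comm]; exact hmN)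
  · rintro ⟨e, ⟨he1, heN⟩, rfl⟩
    refine ⟨⟨?_, ?_⟩, dvd_mul_right d e⟩
    · exact Nat.mul_pos hd he1
    · have := (Nat.le_div_iff_mul_le hd).1 heN
      rw [mul_comm]; exact this

/-- **`∑_{1 ≤ m ≤ N} τ(m)/√m ≤ 2√N (1 + log N)`** (`= ∑_{d} d^{−1/2} ∑_{e ≤ N/d} e^{−1/2} ≤ ∑_d 2√N/d`).
[folklore] -/
theorem sum_card_divisors_div_sqrt_le (N : ℕ) :
    ∑ m ∈ Icc 1 N, ((Nat.divisors m).card : ℝ) / Real.sqrt m ≤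
      2 * Real.sqrt N * (1 + Real.log N) := by
  -- `τ(m)/√m = ∑_{d ≤ N} [d ∣ m]/√m`
  have h1 : ∑ m ∈ Icc 1 N, ((Nat.divisors m).card : ℝ) / Real.sqrt m =
      ∑ m ∈ Icc 1 N, ∑ d ∈ Icc 1 N, (if d ∣ m then 1 / Real.sqrt m else 0) := by
    refine Finset.sum_congr rfl fun m hm => ?_
    rw [Finset.mem_Icc] at hm
    rw [← Finset.sum_filter, Finset.sum_const, nsmul_eq_mul, div_eq_mul_one_div]
    congr 1
    congr 1
    congr 1
    ext d
    simp only [Nat.mem_divisors, Finset.mem_filter, Finset.mem_Icc]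
    constructor
    · rintro ⟨hd, hm0⟩
      exact ⟨⟨Nat.pos_of_dvd_of_pos hd (by omega), (Nat.le_of_dvd (by omega) hd).trans hm.2⟩, hd⟩
    · rintro ⟨⟨-, -⟩, hd⟩
      exact ⟨hd, by omega⟩
  rw [h1, Finset.sum_comm]
  -- inner sums over the multiples of `d`
  have h2 : ∀ d ∈ Icc 1 N, ∑ m ∈ Icc 1 N, (if d ∣ m then 1 / Real.sqrt m else 0) ≤
      2 * Real.sqrt N * (d : ℝ)⁻¹ := by
    intro d hd
    rw [Finset.mem_Icc] at hd
    have hd0 : (0 : ℝ) < d := by exact_mod_cast hd.1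
    rw [← Finset.sum_filter, filter_dvd_Icc_eq_image hd.1,
      Finset.sum_image (fun x _ y _ hxy => Nat.eq_of_mul_eq_mul_left hd.1 hxy)]
    have h3 : ∀ e ∈ Icc 1 (N / d), 1 / Real.sqrt ((d * e : ℕ) : ℝ) =
        (1 / Real.sqrt d) * (1 / Real.sqrt e) := by
      intro e _
      rw [Nat.cast_mul, Real.sqrt_mul (Nat.cast_nonneg d)]
      field_simp
    rw [Finset.sum_congr rfl h3, ← Finset.mul_sum]
    calc 1 / Real.sqrt d * ∑ e ∈ Icc 1 (N / d), 1 / Real.sqrt e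
        ≤ 1 / Real.sqrt d * (2 * Real.sqrt ((N / d : ℕ) : ℝ)) :=
          mul_le_mul_of_nonneg_left (sum_one_div_sqrt_le _) (by positivity)
      _ ≤ 1 / Real.sqrt d * (2 * Real.sqrt ((N : ℝ) / d)) := by
          gcongr
          exact Nat.cast_div_le
      _ = 2 * Real.sqrt N * (d : ℝ)⁻¹ := by
          rw [Real.sqrt_div (Nat.cast_nonneg N)]
          have hsd : Real.sqrt d ≠ 0 := (Real.sqrt_pos.2 hd0).ne'
          field_simp
          rw [Real.sq_sqrt hd0.le]
          ring
  refine (Finset.sum_le_sum h2).trans ?_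
  rw [← Finset.mul_sum]
  have h3 : ∑ d ∈ Icc 1 N, (d : ℝ)⁻¹ = ((harmonic N : ℚ) : ℝ) := by
    rw [harmonic_eq_sum_Icc]; push_cast; rfl
  rw [h3]
  exact mul_le_mul_of_nonneg_left (harmonic_le_one_add_log N) (by positivity)

/-- **`∑_{1 ≤ m ≤ N} τ(m)√m ≤ N√N (1 + log N)`** (each `√m ≤ √N`). [folklore] -/
theorem sum_card_divisors_mul_sqrt_le (N : ℕ) :
    ∑ m ∈ Icc 1 N, ((Nat.divisors m).card : ℝ) * Real.sqrt m ≤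
      (N : ℝ) * Real.sqrt N * (1 + Real.log N) := by
  calc ∑ m ∈ Icc 1 N, ((Nat.divisors m).card : ℝ) * Real.sqrt m
      ≤ ∑ m ∈ Icc 1 N, ((Nat.divisors m).card : ℝ) * Real.sqrt N := by
        refine Finset.sum_le_sum fun m hm => ?_
        rw [Finset.mem_Icc] at hm
        exact mul_le_mul_of_nonneg_left (Real.sqrt_le_sqrt (by exact_mod_cast hm.2))
          (Nat.cast_nonneg _)
    _ = (∑ m ∈ Icc 1 N, ((Nat.divisors m).card : ℝ)) * Real.sqrt N := by rw [Finset.sum_mul]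
    _ ≤ (N * (1 + Real.log N)) * Real.sqrt N :=
        mul_le_mul_of_nonneg_right (sum_card_divisors_le N) (Real.sqrt_nonneg _)
    _ = (N : ℝ) * Real.sqrt N * (1 + Real.log N) := by ring

/-! ### The summation over the moduli `r ≤ R ≍ √N` -/

/-- `(h, s) ≤ |h|` for `h ≠ 0`. [folklore] -/
theorem int_gcd_le_natAbs {h : ℤ} (hh : h ≠ 0) (s : ℕ) : (Int.gcd h s : ℝ) ≤ (h.natAbs : ℝ) := by
  have hI : Int.gcd h s = Nat.gcd h.natAbs s := by
    rw [Int.gcd_eq_natAbs, Int.natAbs_natCast]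
  rw [hI]
  exact_mod_cast Nat.le_of_dvd (Int.natAbs_pos.2 hh) (Nat.gcd_dvd_left _ _)

/-- `∑_{r ≤ R} τ(r)√r (2Λ/r + (1 + log R)) ≤ (4Λ√R + R√R(1 + log R))(1 + log R)` (the two divisor
sums `∑ τ(r)/√r`, `∑ τ(r)√r`). [folklore] -/
theorem sum_card_divisors_sqrt_weight_le (R : ℕ) {Λ : ℝ} (hΛ : 0 ≤ Λ) :
    ∑ r ∈ Icc 1 R, ((Nat.divisors r).card : ℝ) * Real.sqrt r * (2 * Λ / r + (1 + Real.log R)) ≤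
      (4 * Λ * Real.sqrt R + R * Real.sqrt R * (1 + Real.log R)) * (1 + Real.log R) := by
  have hL : 0 ≤ 1 + Real.log R := by
    rcases Nat.eq_zero_or_pos R with h0 | h0
    · subst h0; simp
    · have : (1 : ℝ) ≤ R := by exact_mod_cast h0
      have := Real.log_nonneg this; linarith
  have hsplit : ∀ r ∈ Icc 1 R, ((Nat.divisors r).card : ℝ) * Real.sqrt r * (2 * Λ / r + (1 + Real.log R)) =
      2 * Λ * (((Nat.divisors r).card : ℝ) / Real.sqrt r) +
        (1 + Real.log R) * (((Nat.divisors r).card : ℝ) * Real.sqrt r) := by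
    intro r hr
    rw [Finset.mem_Icc] at hr
    have hr0 : (0 : ℝ) < r := by exact_mod_cast hr.1
    have hsq : Real.sqrt r ≠ 0 := (Real.sqrt_pos.2 hr0).ne'
    field_simp
    rw [Real.sq_sqrt hr0.le]
  rw [Finset.sum_congr rfl hsplit, Finset.sum_add_distrib, ← Finset.mul_sum, ← Finset.mul_sum]
  have h1 := sum_card_divisors_div_sqrt_le R
  have h2 := sum_card_divisors_mul_sqrt_le R
  have hR0 : (0 : ℝ) ≤ Real.sqrt R := Real.sqrt_nonneg _
  nlinarith [mul_le_mul_of_nonneg_left h1 (by positivity : (0 : ℝ) ≤ 2 * Λ),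
    mul_le_mul_of_nonneg_left h2 hL]

/-- **The summation over the moduli.**  Let `h ≠ 0` and `c₁, c₂, c₃ ≥ 0`.  There is `C ≥ 0` such
that for all `N ≥ 1`, all `R ≤ c₁√N`, all families of integer intervals `(a_r, b_r)` of length
`b_r − a_r ≤ c₂√N` and all twists with `|w_r(p) − 1| ≤ c₃/r²` on `(a_r, b_r)` (`1 ≤ r ≤ R`),
`|∑_{r ≤ R} ∑_{a_r < p < b_r, (p,r)=1} e(h p̄/r) w_r(p)| ≤ C N^{3/4} (1 + log N)²`.
(Per `r`: `norm_sum_Ioo_hooleyPhase_mul_le`; then `∑_{r ≤ R} τ(r)/√r ≤ 2√R(1 + log R)`,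
`∑_{r ≤ R} τ(r)√r ≤ R√R(1 + log R)`, `∑ 1/r² ≤ 2`.)  This is the bookkeeping of Hooley's §6 with
both logarithms kept. [cite: Hooley1963, §6] -/
theorem exists_norm_sum_sum_hooleyPhase_mul_le {h : ℤ} (hh : h ≠ 0) {c₁ c₂ c₃ : ℝ}
    (hc₁ : 0 ≤ c₁) (hc₂ : 0 ≤ c₂) (hc₃ : 0 ≤ c₃) :
    ∃ C : ℝ, 0 ≤ C ∧ ∀ (N R : ℕ) (a b : ℕ → ℤ) (w : ℕ → ℤ → ℂ), 1 ≤ N →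
      (R : ℝ) ≤ c₁ * Real.sqrt N →
      (∀ r ∈ Icc 1 R, a r ≤ b r ∧ ((b r - a r : ℤ) : ℝ) ≤ c₂ * Real.sqrt N) →
      (∀ r ∈ Icc 1 R, ∀ p ∈ Finset.Ioo (a r) (b r), ‖w r p - 1‖ ≤ c₃ / (r : ℝ) ^ 2) →
      ‖∑ r ∈ Icc 1 R, ∑ p ∈ (Finset.Ioo (a r) (b r)).filter (fun p : ℤ => Int.gcd p r = 1),
          hooleyPhase h r p * w r p‖ ≤ C * ((N : ℝ) ^ (3 / 4 : ℝ) * (1 + Real.log N) ^ 2) := by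
  set κ : ℝ := 1 + max 0 (Real.log c₁) with hκ
  have hκ1 : 1 ≤ κ := by rw [hκ]; have := le_max_left 0 (Real.log c₁); linarith
  set H : ℝ := Real.sqrt (h.natAbs : ℝ) with hH
  have hH0 : 0 ≤ H := Real.sqrt_nonneg _
  refine ⟨H * (4 * c₂ * Real.sqrt c₁ * κ ^ 2 + c₁ * Real.sqrt c₁ * κ ^ 2) + 2 * c₂ * c₃,
    by positivity, ?_⟩
  intro N R a b w hN hR hab hw
  have hN0 : (0 : ℝ) < N := by exact_mod_cast hN
  have hN1 : (1 : ℝ) ≤ N := by exact_mod_cast hN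
  set L : ℝ := 1 + Real.log N with hLdef
  have hlogN : 0 ≤ Real.log N := Real.log_nonneg hN1
  have hL1 : 1 ≤ L := by rw [hLdef]; linarith
  set Λ : ℝ := c₂ * Real.sqrt N with hΛdef
  have hΛ0 : 0 ≤ Λ := by positivity
  set M : ℝ := Real.sqrt N * Real.sqrt (Real.sqrt N) with hMdef
  have hM : M = (N : ℝ) ^ (3 / 4 : ℝ) := by
    rw [hMdef, Real.sqrt_eq_rpow, Real.sqrt_eq_rpow, ← Real.rpow_mul hN0.le,
      ← Real.rpow_add' hN0.le (by norm_num)]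
    norm_num
  have hsN1 : 1 ≤ Real.sqrt N := by rw [← Real.sqrt_one]; exact Real.sqrt_le_sqrt hN1
  have hssN1 : 1 ≤ Real.sqrt (Real.sqrt N) := by rw [← Real.sqrt_one]; exact Real.sqrt_le_sqrt hsN1
  have hM1 : Real.sqrt N ≤ M := by rw [hMdef]; exact le_mul_of_one_le_right (by positivity) hssN1
  rw [← hM]
  -- the case `R = 0` is trivial
  rcases Nat.eq_zero_or_pos R with hR0 | hR0
  · subst hR0
    simp only [Finset.Icc_eq_empty_of_lt (show 0 < 1 by norm_num), Finset.sum_empty, norm_zero]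
    positivity
  have hR1 : (1 : ℝ) ≤ R := by exact_mod_cast hR0
  have hlogR : 0 ≤ Real.log R := Real.log_nonneg hR1
  -- Step 1: the bound for each `r`
  have hper : ∀ r ∈ Icc 1 R,
      ‖∑ p ∈ (Finset.Ioo (a r) (b r)).filter (fun p : ℤ => Int.gcd p r = 1), hooleyPhase h r p * w r p‖ ≤
        H * (((Nat.divisors r).card : ℝ) * Real.sqrt r * (2 * Λ / r + (1 + Real.log R))) +
          Λ * c₃ * (1 / (r : ℝ) ^ 2) := by
    intro r hr
    have hr' := hr
    rw [Finset.mem_Icc] at hr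
    have hr0 : (0 : ℝ) < r := by exact_mod_cast hr.1
    obtain ⟨hab', hlen⟩ := hab r hr'
    have h1 := norm_sum_Ioo_hooleyPhase_mul_le hr.1 h (a r) (b r) hab' (w r)
      (by positivity : (0 : ℝ) ≤ c₃ / (r : ℝ) ^ 2) (hw r hr')
    refine h1.trans ?_
    have hgcd : Real.sqrt (Int.gcd h r) ≤ H := Real.sqrt_le_sqrt (int_gcd_le_natAbs hh r)
    have hlog : Real.log r ≤ Real.log R := Real.log_le_log hr0 (by exact_mod_cast hr.2)
    have hlen' : 2 * ((b r - a r : ℤ) : ℝ) / r ≤ 2 * Λ / r := by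
      gcongr
    have hτ : 0 ≤ ((Nat.divisors r).card : ℝ) * Real.sqrt r := by positivity
    have hA : ((Nat.divisors r).card : ℝ) * Real.sqrt r * Real.sqrt (Int.gcd h r) *
        (2 * ((b r - a r : ℤ) : ℝ) / r + 1 + Real.log r) ≤
        H * (((Nat.divisors r).card : ℝ) * Real.sqrt r * (2 * Λ / r + (1 + Real.log R))) := by
      have hw1 : 0 ≤ 2 * ((b r - a r : ℤ) : ℝ) / r + 1 + Real.log r := by
        have : 0 ≤ ((b r - a r : ℤ) : ℝ) := by exact_mod_cast (by omega : (0 : ℤ) ≤ b r - a r)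
        have : 0 ≤ Real.log r := Real.log_nonneg (by exact_mod_cast hr.1)
        positivity
      calc ((Nat.divisors r).card : ℝ) * Real.sqrt r * Real.sqrt (Int.gcd h r) *
            (2 * ((b r - a r : ℤ) : ℝ) / r + 1 + Real.log r)
          ≤ ((Nat.divisors r).card : ℝ) * Real.sqrt r * H * (2 * Λ / r + (1 + Real.log R)) := by
            apply mul_le_mul (mul_le_mul_of_nonneg_left hgcd hτ) (by linarith) hw1 (by positivity)
        _ = H * (((Nat.divisors r).card : ℝ) * Real.sqrt r * (2 * Λ / r + (1 + Real.log R))) := by ring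
    have hB : ((b r - a r : ℤ) : ℝ) * (c₃ / (r : ℝ) ^ 2) ≤ Λ * c₃ * (1 / (r : ℝ) ^ 2) := by
      rw [show Λ * c₃ * (1 / (r : ℝ) ^ 2) = Λ * (c₃ / (r : ℝ) ^ 2) by ring]
      exact mul_le_mul_of_nonneg_right hlen (by positivity)
    linarith
  -- Step 2: sum over `r`
  have hsum : ‖∑ r ∈ Icc 1 R, ∑ p ∈ (Finset.Ioo (a r) (b r)).filter (fun p : ℤ => Int.gcd p r = 1),
      hooleyPhase h r p * w r p‖ ≤
      H * ((4 * Λ * Real.sqrt R + R * Real.sqrt R * (1 + Real.log R)) * (1 + Real.log R)) +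
        Λ * c₃ * 2 := by
    refine (norm_sum_le _ _).trans ((Finset.sum_le_sum hper).trans ?_)
    rw [Finset.sum_add_distrib, ← Finset.mul_sum, ← Finset.mul_sum]
    have h1 := sum_card_divisors_sqrt_weight_le R hΛ0
    -- `∑_{1 ≤ r ≤ R} 1/r² ≤ 2` (cf. the tree's `Green2012.sum_Icc_inv_sq_le_two`)
    have h2 : ∑ r ∈ Icc 1 R, 1 / ((r : ℝ) ^ 2) ≤ 2 := by
      have h : Icc 1 R = Ioo 0 (R + 1) := by
        ext r; simp only [Finset.mem_Icc, Finset.mem_Ioo]; omega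
      rw [h]
      have := sum_Ioo_inv_sq_le (α := ℝ) 0 (R + 1)
      simp only [Nat.cast_zero, zero_add, div_one] at this
      simpa only [one_div] using this
    nlinarith [mul_le_mul_of_nonneg_left h1 hH0, mul_le_mul_of_nonneg_left h2 (by positivity : 0 ≤ Λ * c₃)]
  refine hsum.trans ?_
  -- Step 3: `R ≤ c₁ √N`
  have hc₁0 : 0 < c₁ := by
    by_contra hle
    have : c₁ = 0 := le_antisymm (not_lt.1 hle) hc₁
    rw [this, zero_mul] at hR
    linarith
  have hsR : Real.sqrt R ≤ Real.sqrt c₁ * Real.sqrt (Real.sqrt N) := by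
    rw [← Real.sqrt_mul hc₁]; exact Real.sqrt_le_sqrt hR
  have hLR : 1 + Real.log R ≤ κ * L := by
    have h1 : Real.log R ≤ Real.log (c₁ * Real.sqrt N) := Real.log_le_log (by linarith) hR
    rw [Real.log_mul hc₁0.ne' (by positivity), Real.log_sqrt hN0.le] at h1
    have h2 : Real.log c₁ ≤ max 0 (Real.log c₁) := le_max_right _ _
    have h3 : 1 + Real.log R ≤ κ + Real.log N := by rw [hκ]; linarith
    calc 1 + Real.log R ≤ κ + Real.log N := h3
      _ ≤ κ * L := by rw [hLdef]; nlinarith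
  have hLR0 : 0 ≤ 1 + Real.log R := by linarith
  -- the three terms
  have hT1 : 4 * Λ * Real.sqrt R ≤ 4 * c₂ * Real.sqrt c₁ * κ * (M * L) := by
    calc 4 * Λ * Real.sqrt R ≤ 4 * Λ * (Real.sqrt c₁ * Real.sqrt (Real.sqrt N)) :=
          mul_le_mul_of_nonneg_left hsR (by positivity)
      _ = 4 * c₂ * Real.sqrt c₁ * M := by rw [hΛdef, hMdef]; ring
      _ ≤ 4 * c₂ * Real.sqrt c₁ * κ * (M * L) := by
          have hM0 : 0 ≤ M := by positivity
          have : M ≤ κ * (M * L) := by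
            calc M = 1 * (M * 1) := by ring
              _ ≤ κ * (M * L) := mul_le_mul hκ1 (mul_le_mul_of_nonneg_left hL1 hM0) (by positivity)
                  (by positivity)
          calc 4 * c₂ * Real.sqrt c₁ * M = (4 * c₂ * Real.sqrt c₁) * M := by ring
            _ ≤ (4 * c₂ * Real.sqrt c₁) * (κ * (M * L)) := mul_le_mul_of_nonneg_left this (by positivity)
            _ = 4 * c₂ * Real.sqrt c₁ * κ * (M * L) := by ring
  have hT2 : R * Real.sqrt R * (1 + Real.log R) ≤ c₁ * Real.sqrt c₁ * κ * (M * L) := by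
    have h1 : (R : ℝ) * Real.sqrt R ≤ c₁ * Real.sqrt c₁ * M := by
      calc (R : ℝ) * Real.sqrt R ≤ (c₁ * Real.sqrt N) * (Real.sqrt c₁ * Real.sqrt (Real.sqrt N)) :=
            mul_le_mul hR hsR (Real.sqrt_nonneg _) (by positivity)
        _ = c₁ * Real.sqrt c₁ * M := by rw [hMdef]; ring
    calc (R : ℝ) * Real.sqrt R * (1 + Real.log R) ≤ (c₁ * Real.sqrt c₁ * M) * (κ * L) :=
          mul_le_mul h1 hLR hLR0 (by positivity)
      _ = c₁ * Real.sqrt c₁ * κ * (M * L) := by ring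
  have hT3 : Λ * c₃ * 2 ≤ 2 * c₂ * c₃ * (M * L ^ 2) := by
    have : Real.sqrt N ≤ M * L ^ 2 := by
      calc Real.sqrt N ≤ M := hM1
        _ = M * 1 := (mul_one M).symm
        _ ≤ M * L ^ 2 := mul_le_mul_of_nonneg_left (by nlinarith) (by positivity)
    calc Λ * c₃ * 2 = 2 * c₂ * c₃ * Real.sqrt N := by rw [hΛdef]; ring
      _ ≤ 2 * c₂ * c₃ * (M * L ^ 2) := mul_le_mul_of_nonneg_left this (by positivity)
  have hsum2 : (4 * Λ * Real.sqrt R + R * Real.sqrt R * (1 + Real.log R)) * (1 + Real.log R) ≤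
      (4 * c₂ * Real.sqrt c₁ * κ ^ 2 + c₁ * Real.sqrt c₁ * κ ^ 2) * (M * L ^ 2) := by
    calc (4 * Λ * Real.sqrt R + R * Real.sqrt R * (1 + Real.log R)) * (1 + Real.log R)
        ≤ (4 * c₂ * Real.sqrt c₁ * κ * (M * L) + c₁ * Real.sqrt c₁ * κ * (M * L)) * (κ * L) :=
          mul_le_mul (add_le_add hT1 hT2) hLR hLR0 (by positivity)
      _ = (4 * c₂ * Real.sqrt c₁ * κ ^ 2 + c₁ * Real.sqrt c₁ * κ ^ 2) * (M * L ^ 2) := by ring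
  calc H * ((4 * Λ * Real.sqrt R + R * Real.sqrt R * (1 + Real.log R)) * (1 + Real.log R)) + Λ * c₃ * 2
      ≤ H * ((4 * c₂ * Real.sqrt c₁ * κ ^ 2 + c₁ * Real.sqrt c₁ * κ ^ 2) * (M * L ^ 2)) +
          2 * c₂ * c₃ * (M * L ^ 2) := add_le_add (mul_le_mul_of_nonneg_left hsum2 hH0) hT3
    _ = (H * (4 * c₂ * Real.sqrt c₁ * κ ^ 2 + c₁ * Real.sqrt c₁ * κ ^ 2) + 2 * c₂ * c₃) *
          (M * L ^ 2) := by ring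

end Literature.NumberTheory.Sieve.Hooley1963

end
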